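import Summits.Ventures.Crystal3D.Theorems.StickyWulffConstantGenericWallFloorStackLedgerLocalCountSep
import Summits.Ventures.Crystal3D.Theorems.StickyWulffConstantGenericWallFloorStackLedgerNonChain
import Summits.Ventures.Crystal3D.Theorems.StickyWulffConstantGenericWallFloorWalkReach
import HarnessLib

/-!
# The stack ledger for DISJOINT REACH SETS: full charge `½(κ₁+κ₂)`, no residual, no separation / co-axiality hypothesis
# (crux `GenericWallFloor`, stmt-Ventures-19480, line `WallLedgerG`; the arrival case split, generic branch)

HONEST FRAMING. Venture `Summits/Ventures/Crystal3D` (cell `crystal3d-full`), helper `--supports` the crux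
`GenericWallFloor` of `route-Ventures-StickyWulffConstant`, REGISTERED line `WallLedgerG`, open stub
`stub_twoSlabAdhesion`.  Rung credit only; F-C1 not moved; NOT the stub: `ExactOnly`(C12-55) [E1] and
`DoubleStarCoaxialAt`/`CapPairCoaxial` [= `StarPairFar`] remain BY NAME; REGISTERED relative translations are not covered.
`twoSlabAdhesion_stackLedger_local_sep` (19480-p2 g4) used frame-set SEPARATION at three places: (a)/(b) no walker ends
inside the far clamped sample, (c) at a double end the two closed stars are non-co-axial.  A walker's POSITION never leaves
the reach set `reachSet Aᵢ tᵢ Mᵢ = Aᵢ·Λ₀ + tᵢ + reachGroup Mᵢ` (`…WalkReach`) and the far sample lies in the far reach set;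
so if the two reach sets are DISJOINT (`t₂ − t₁` off the countable registry set, `reachSet_disjoint_iff`), (a)/(b) hold by
slab sealing (`sealing_above/below`) and (c) is VACUOUS (no ball carries ends of both grains; the count
`card_contacts_add_endStates_le_twelve_sep` is used with the other family empty) — for EVERY pair, co-axial or not.
**`twoSlabAdhesion_stackLedger_offReach`**: steep slots `u₁`/`u₂`, frame sets `Mᵢ ∋` the frames of all sound well-formed
stacks over the bottoms, disjoint reach sets ⇒ `R₀ = 10`, explicit `C`, and in every cell of `TwoSlabAdhesion`
`cross(P₁,X∖P₁) + cross(P₂,Y) ≤ D(Y) + (φ₁ + φ₂ − ½(κ₁+κ₂))πρ² + C(1+h)ρ` (the `local_sep` proof verbatim up to (a)–(c)).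
WHAT THIS IS NOT: not the stub — registered translations (coherent lamellae, risers) are the remaining core; F-C1 not moved.
-/

noncomputable section

namespace Summit.Ventures.Crystal3D.Theorems

open Summit.Ventures.Crystal3D Finset
open Literature.MathematicalPhysics.StatisticalMechanics (fccStacking barlowStacking IsHaggSeq contactDeficiency)
open scoped InnerProductSpace

open scoped Classical in
/-- **The stack ledger for disjoint reach sets (full charge, no residual, no separation, no co-axiality hypothesis).**
See the module docstring. -/
theorem twoSlabAdhesion_stackLedger_offReach
    {s₀ : EuclideanSpace ℝ (Fin 3)} (hs₀ : s₀ ∈ fccSlots)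
    (hcert : ExactOnly 0 (fccSlots.filter fun w => 0 < ⟪w, s₀⟫_ℝ))
    (hDS : ∀ F₁ F₂ : EuclideanSpace ℝ (Fin 3) ≃ₗᵢ[ℝ] EuclideanSpace ℝ (Fin 3), DoubleStarCoaxialAt F₁ F₂)
    (hCP : CapPairCoaxial)
    (A₁ : EuclideanSpace ℝ (Fin 3) ≃ₗᵢ[ℝ] EuclideanSpace ℝ (Fin 3)) (t₁ : EuclideanSpace ℝ (Fin 3))
    (A₂ : EuclideanSpace ℝ (Fin 3) ≃ₗᵢ[ℝ] EuclideanSpace ℝ (Fin 3)) (t₂ : EuclideanSpace ℝ (Fin 3))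
    {u₁ : EuclideanSpace ℝ (Fin 3)} (hu₁ : u₁ ∈ fccSlots)
    (hsteep₁ : Real.sqrt 2 / 2 ≤ ⟪A₁ u₁, EuclideanSpace.single (2 : Fin 3) (1 : ℝ)⟫_ℝ)
    {u₂ : EuclideanSpace ℝ (Fin 3)} (hu₂ : u₂ ∈ fccSlots)
    (hsteep₂ : ⟪A₂ u₂, EuclideanSpace.single (2 : Fin 3) (1 : ℝ)⟫_ℝ ≤ -(Real.sqrt 2 / 2))
    (M₁ M₂ : Set (EuclideanSpace ℝ (Fin 3) ≃ₗᵢ[ℝ] EuclideanSpace ℝ (Fin 3)))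
    (hM₁ : ∀ stk : List WalkEntry, StackSound (EuclideanSpace.single (2 : Fin 3) (1 : ℝ)) stk →
      StackWF (EuclideanSpace.single (2 : Fin 3) (1 : ℝ)) stk → stk.getLast? = some ⟨A₁, u₁, 0⟩ →
      ∀ e ∈ stk, e.frame ∈ M₁)
    (hM₂ : ∀ stk : List WalkEntry, StackSound (-EuclideanSpace.single (2 : Fin 3) (1 : ℝ)) stk →
      StackWF (-EuclideanSpace.single (2 : Fin 3) (1 : ℝ)) stk → stk.getLast? = some ⟨A₂, u₂, 0⟩ →
      ∀ e ∈ stk, e.frame ∈ M₂)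
    (hoff : ∀ y ∈ reachSet A₁ t₁ M₁, y ∉ reachSet A₂ t₂ M₂) :
    ∃ C R₀ : ℝ, 1 ≤ R₀ ∧ ∀ h : ℝ, 0 ≤ h → ∀ ρ : ℝ, R₀ ≤ ρ →
      ∀ X P₁ P₂ : Finset (EuclideanSpace ℝ (Fin 3)),
      (∀ p ∈ X, ∀ q ∈ X, p ≠ q → 1 ≤ dist p q) → P₁ ⊆ X → P₂ ⊆ X \ P₁ →
      (∀ p ∈ X, -(2 * R₀) ≤ p 2 ∧ p 2 ≤ h + 2 * R₀ ∧ p 0 ^ 2 + p 1 ^ 2 ≤ ρ ^ 2) →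
      (∀ p, p ∈ P₁ ↔ (p ∈ (fun q => A₁ q + t₁) '' fccStacking 1 (Real.sqrt (2 / 3)) ∧
        -(2 * R₀) ≤ p 2 ∧ p 2 ≤ -R₀ ∧ p 0 ^ 2 + p 1 ^ 2 ≤ ρ ^ 2)) →
      (∀ p, p ∈ P₂ ↔ (p ∈ (fun q => A₂ q + t₂) '' fccStacking 1 (Real.sqrt (2 / 3)) ∧
        h + R₀ ≤ p 2 ∧ p 2 ≤ h + 2 * R₀ ∧ p 0 ^ 2 + p 1 ^ 2 ≤ ρ ^ 2)) →
      ((((P₁ ×ˢ (X \ P₁)).filter fun pq => dist pq.1 pq.2 = 1).card : ℕ) : ℝ) +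
        ((((P₂ ×ˢ ((X \ P₁) \ P₂)).filter fun pq => dist pq.1 pq.2 = 1).card : ℕ) : ℝ) ≤
        contactDeficiency ((X \ P₁) \ P₂) +
          (Real.sqrt 2 / 4 * ∑ᶠ w ∈ {w ∈ fccStacking 1 (Real.sqrt (2 / 3)) | ‖w‖ = 1},
              |⟪w, A₁.symm (EuclideanSpace.single (2 : Fin 3) (1 : ℝ))⟫_ℝ| +
            Real.sqrt 2 / 4 * ∑ᶠ w ∈ {w ∈ fccStacking 1 (Real.sqrt (2 / 3)) | ‖w‖ = 1},
              |⟪w, A₂.symm (EuclideanSpace.single (2 : Fin 3) (1 : ℝ))⟫_ℝ| -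
            (Real.sqrt 2 * |⟪A₁ u₁, EuclideanSpace.single (2 : Fin 3) (1 : ℝ)⟫_ℝ| +
              Real.sqrt 2 * |⟪A₂ u₂, EuclideanSpace.single (2 : Fin 3) (1 : ℝ)⟫_ℝ|) / 2) * Real.pi * ρ ^ 2 +
          C * (1 + h) * ρ := by
  obtain ⟨C₁, hC₁⟩ := affineSampleDeficit_upper A₁ t₁ 10 (by norm_num)
  obtain ⟨C₂, hC₂⟩ := affineSampleDeficit_upper A₂ t₂ 10 (by norm_num)
  refine ⟨(240 * Real.sqrt 2 * Real.pi + 4440 * (4 * 10 + 2)) / 2 + 2000 + |C₁| + |C₂|, 10, by norm_num, ?_⟩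
  intro h hh ρ hρ X P₁ P₂ hX hP₁X hP₂X hcell hP₁ hP₂
  set e₃ : EuclideanSpace ℝ (Fin 3) := EuclideanSpace.single (2 : Fin 3) (1 : ℝ) with he₃
  have he₃n : ‖e₃‖ = 1 := (by rw [he₃, PiLp.norm_single, norm_one]); have hme₃n : ‖-e₃‖ = 1 := by rw [norm_neg, he₃n]
  have he₃i : ∀ d : EuclideanSpace ℝ (Fin 3), ⟪d, e₃⟫_ℝ = d 2 := fun d => by rw [he₃, EuclideanSpace.inner_single_right]; simp
  have hsteep₂' : Real.sqrt 2 / 2 ≤ ⟪A₂ u₂, -e₃⟫_ℝ := by rw [inner_neg_right]; linarith only [hsteep₂]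
  -- the two base frames lie in their frame sets (the start stacks are sound and well formed)
  have hA₁M : A₁ ∈ M₁ := hM₁ [⟨A₁, u₁, 0⟩] ⟨hu₁, hsteep₁⟩ rfl rfl ⟨A₁, u₁, 0⟩ (List.mem_singleton_self _)
  have hA₂M : A₂ ∈ M₂ := hM₂ [⟨A₂, u₂, 0⟩] ⟨hu₂, hsteep₂'⟩ rfl rfl ⟨A₂, u₂, 0⟩ (List.mem_singleton_self _)
  set φ₁ : ℝ := Real.sqrt 2 / 4 * ∑ᶠ w ∈ {w ∈ fccStacking 1 (Real.sqrt (2 / 3)) | ‖w‖ = 1}, |⟪w, A₁.symm (EuclideanSpace.single (2 : Fin 3) (1 : ℝ))⟫_ℝ| with hφ₁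
  set φ₂ : ℝ := Real.sqrt 2 / 4 * ∑ᶠ w ∈ {w ∈ fccStacking 1 (Real.sqrt (2 / 3)) | ‖w‖ = 1}, |⟪w, A₂.symm (EuclideanSpace.single (2 : Fin 3) (1 : ℝ))⟫_ℝ| with hφ₂
  have hP₂X' : P₂ ⊆ X := hP₂X.trans Finset.sdiff_subset
  obtain ⟨hρ0, hρ1⟩ : (0 : ℝ) ≤ ρ ∧ (1 : ℝ) ≤ ρ := ⟨by linarith, by linarith⟩
  set L : ℝ := 8 / 3 * (h + 4 * 10) with hL; have hL0 : 0 ≤ L := (by rw [hL]; positivity); set N : ℕ := ⌈3 * (h + 4 * 10 + 1)⌉₊ with hNdef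
  set ρs : ℝ := ρ - 3 - 8 / 3 * (h + 4 * 10) with hρs
  set deg : EuclideanSpace ℝ (Fin 3) → ℕ := fun x => (X.filter fun q => dist x q = 1).card with hdeg
  have hdeg12 : ∀ x, deg x ≤ 12 := fun x => card_filter_dist_eq_one_le_twelve X hX x
  set PAY := X.filter fun y => (X.filter fun q => dist y q = 1).card ≠ 12 ∧ -10 - 2 ≤ y 2 ∧ y 2 ≤ h + 10 + 2 with hPAY
  -- the weighted interior ledger
  have hled := ledger_ge_faces_add_interior_credits A₁ t₁ A₂ t₂ X P₁ P₂ 10 h ρ le_rfl hh hρ hX hcell hP₁X hP₂X' hP₁ hP₂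
  rw [← finsum_unit_fcc_symm_eq_sum_slots A₁, ← finsum_unit_fcc_symm_eq_sum_slots A₂, ← hφ₁, ← hφ₂, ← hPAY] at hled
  -- fuel
  have hN : (3 : ℝ) * (h + 4 * 10 + 1) ≤ (N : ℝ) := by rw [hNdef]; exact Nat.le_ceil _
  -- fluxes
  set κ₁ : ℝ := Real.sqrt 2 * |⟪A₁ u₁, e₃⟫_ℝ| with hκ₁
  set κ₂ : ℝ := Real.sqrt 2 * |⟪A₂ u₂, e₃⟫_ℝ| with hκ₂
  have hsq : 0 ≤ Real.sqrt 2 := Real.sqrt_nonneg 2; have hπ : Real.pi ≤ 4 := Real.pi_le_four; have hπ0 : 0 ≤ Real.pi := Real.pi_pos.le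
  have hs2' : Real.sqrt 2 ≤ 2 := by rw [show (2 : ℝ) = Real.sqrt (2 ^ 2) by rw [Real.sqrt_sq (by norm_num)]]; exact Real.sqrt_le_sqrt (by norm_num)
  have hκ₁0 : 0 ≤ κ₁ := mul_nonneg hsq (abs_nonneg _); have hκ₂0 : 0 ≤ κ₂ := mul_nonneg hsq (abs_nonneg _)
  have hκ₁2 : κ₁ ≤ 2 := by
    have := mul_le_mul hs2' (abs_inner_slot_le_one A₁ hu₁) (abs_nonneg _) (by norm_num); linarith
  have hκ₂2 : κ₂ ≤ 2 := by
    have := mul_le_mul hs2' (abs_inner_slot_le_one A₂ hu₂) (abs_nonneg _) (by norm_num); linarith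
  -- dummy second bottoms (the count lemma is used with ONE family at a time)
  have hu₁0 : A₁ u₁ ≠ 0 := fun h0 => by
    have := norm_eq_one_of_mem_fccSlots hu₁; rw [← LinearIsometryEquiv.norm_map A₁, h0, norm_zero] at this; exact zero_ne_one this
  have hu₂0 : A₂ u₂ ≠ 0 := fun h0 => by
    have := norm_eq_one_of_mem_fccSlots hu₂; rw [← LinearIsometryEquiv.norm_map A₂, h0, norm_zero] at this; exact zero_ne_one this
  have hbb₁ : (⟨A₁, u₁, 0⟩ : WalkEntry) ≠ ⟨A₁, u₁, A₁ u₁⟩ := fun hb => hu₁0 (congrArg WalkEntry.nrm hb).symm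
  have hbb₂ : (⟨A₂, u₂, A₂ u₂⟩ : WalkEntry) ≠ ⟨A₂, u₂, 0⟩ := fun hb => hu₂0 (congrArg WalkEntry.nrm hb)
  -- the main estimate: the payer sum dominates the tops, up to the flux loss
  have hmain : (κ₁ + κ₂) * Real.pi * ρ ^ 2 - 2 * 2000 * (1 + h) * ρ ≤
      (∑ y ∈ PAY, ((12 : ℝ) - ((X.filter fun q => dist y q = 1).card : ℝ))) := by
    have hPAY0 : 0 ≤ ∑ y ∈ PAY, ((12 : ℝ) - ((X.filter fun q => dist y q = 1).card : ℝ)) :=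
      Finset.sum_nonneg fun y _ => by
        have h'' : ((X.filter fun q => dist y q = 1).card : ℝ) ≤ 12 := (by exact_mod_cast hdeg12 y); linarith
    by_cases hbig : 11 + L ≤ ρ
    · -- BIG CELL: run the walkers
      have hρs8 : 8 ≤ ρs := by rw [hρs]; linarith
      have hρs0 : 0 ≤ ρs := by linarith
      have hρs17 : ρs + 16 ≤ ρ - 1 := by rw [hρs]; linarith only [hh, hL, hL0]
      have hρsρ : ρs ≤ ρ - 1 := by linarith only [hρs17]
      have hρs2 : ρs ^ 2 ≤ ρ ^ 2 := (by nlinarith only [hρs0, hρsρ]); have hρs3 : ρs ^ 2 ≤ (ρ - 1) ^ 2 := by nlinarith only [hρs0, hρsρ]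
      -- the inner samples, tops and end-state maps
      set S₁ := P₁.filter fun p => (-19 : ℝ) ≤ p 2 ∧ p 2 ≤ -19 + 8 ∧ p 0 ^ 2 + p 1 ^ 2 ≤ ρs ^ 2 with hS₁def
      set S₂ := P₂.filter fun p => (h + 11) ≤ p 2 ∧ p 2 ≤ (h + 11) + 8 ∧ p 0 ^ 2 + p 1 ^ 2 ≤ ρs ^ 2 with hS₂def
      set T₁ := S₁.filter fun p => p + A₁ u₁ ∉ S₁ with hT₁def
      set T₂ := S₂.filter fun p => p + A₂ u₂ ∉ S₂ with hT₂def
      set f₁ : EuclideanSpace ℝ (Fin 3) → EuclideanSpace ℝ (Fin 3) × List WalkEntry := fun p => walkRun X e₃ N (p + A₁ u₁, [⟨A₁, u₁, 0⟩]) with hf₁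
      set f₂ : EuclideanSpace ℝ (Fin 3) → EuclideanSpace ℝ (Fin 3) × List WalkEntry := fun p => walkRun X (-e₃) N (p + A₂ u₂, [⟨A₂, u₂, 0⟩]) with hf₂
      have hS₁mem : ∀ p, p ∈ S₁ ↔ (p ∈ P₁ ∧ (-19 : ℝ) ≤ p 2 ∧ p 2 ≤ -19 + 8 ∧ p 0 ^ 2 + p 1 ^ 2 ≤ ρs ^ 2) := fun p => by rw [hS₁def, Finset.mem_filter]
      have hS₂mem : ∀ p, p ∈ S₂ ↔ (p ∈ P₂ ∧ (h + 11) ≤ p 2 ∧ p 2 ≤ (h + 11) + 8 ∧ p 0 ^ 2 + p 1 ^ 2 ≤ ρs ^ 2) := fun p => by rw [hS₂def, Finset.mem_filter]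
      have hS₁ : ∀ p, p ∈ S₁ ↔ (p ∈ (fun q => A₁ q + t₁) '' fccStacking 1 (Real.sqrt (2 / 3)) ∧
          (-19 : ℝ) ≤ p 2 ∧ p 2 ≤ -19 + 8 ∧ p 0 ^ 2 + p 1 ^ 2 ≤ ρs ^ 2) := by
        intro p; rw [hS₁def, Finset.mem_filter, hP₁]; constructor
        · rintro ⟨⟨hΛ, -, -, -⟩, h1, h2, h3⟩; exact ⟨hΛ, by linarith only [h1], by linarith only [h2], h3⟩
        · rintro ⟨hΛ, h1, h2, h3⟩; exact ⟨⟨hΛ, by linarith only [h1], by linarith only [h2], by linarith only [h3, hρs2]⟩, h1, h2, h3⟩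
      have hS₂ : ∀ p, p ∈ S₂ ↔ (p ∈ (fun q => A₂ q + t₂) '' fccStacking 1 (Real.sqrt (2 / 3)) ∧
          (h + 11) ≤ p 2 ∧ p 2 ≤ (h + 11) + 8 ∧ p 0 ^ 2 + p 1 ^ 2 ≤ ρs ^ 2) := by
        intro p; rw [hS₂def, Finset.mem_filter, hP₂]; constructor
        · rintro ⟨⟨hΛ, -, -, -⟩, h1, h2, h3⟩; exact ⟨hΛ, by linarith only [h1], by linarith only [h2], h3⟩
        · rintro ⟨hΛ, h1, h2, h3⟩; exact ⟨⟨hΛ, by linarith only [h1, hh], by linarith only [h2], by linarith only [h3, hρs2]⟩, h1, h2, h3⟩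
      -- the tops counts
      obtain ⟨Ea, Eb, hEa, hEb, hdet, hframe, -⟩ := exists_frame_of_mem_fccSlots hu₁
      have hT₁ := tops_ge_lineCount A₁ t₁ (-19) 8 ρs (by norm_num) hρs8 S₁ hS₁ Ea Eb u₁ hEa hEb (norm_eq_one_of_mem_fccSlots hu₁) hdet hframe
      obtain ⟨Ea', Eb', hEa', hEb', hdet', hframe', -⟩ := exists_frame_of_mem_fccSlots hu₂
      have hT₂ := tops_ge_lineCount A₂ t₂ (h + 11) 8 ρs (by norm_num) hρs8 S₂ hS₂ Ea' Eb' u₂ hEa' hEb'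
        (norm_eq_one_of_mem_fccSlots hu₂) hdet' hframe'
      have hT₁' : κ₁ * Real.pi * ρs ^ 2 - 10 * Real.sqrt 2 * Real.pi * ρs ≤ (T₁.card : ℝ) := by rw [hT₁def]; exact hT₁
      have hT₂' : κ₂ * Real.pi * ρs ^ 2 - 10 * Real.sqrt 2 * Real.pi * ρs ≤ (T₂.card : ℝ) := by rw [hT₂def]; exact hT₂
      have hflux : ∀ κ : ℝ, 0 ≤ κ → κ ≤ 2 → κ * Real.pi * ρ ^ 2 - 2000 * (1 + h) * ρ ≤ κ * Real.pi * ρs ^ 2 - 10 * Real.sqrt 2 * Real.pi * ρs :=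
        fun κ hκ0 hκ2 => flux_loss_inner_disc hκ0 hκ2 hh hρ0 (by rw [hρs]) hρs0 hρsρ
      have hT₁'' : κ₁ * Real.pi * ρ ^ 2 - 2000 * (1 + h) * ρ ≤ (T₁.card : ℝ) := le_trans (hflux κ₁ hκ₁0 hκ₁2) hT₁'
      have hT₂'' : κ₂ * Real.pi * ρ ^ 2 - 2000 * (1 + h) * ρ ≤ (T₂.card : ℝ) := le_trans (hflux κ₂ hκ₂0 hκ₂2) hT₂'
      -- lateral bookkeeping
      have hlat_of : ∀ (y₀ y : EuclideanSpace ℝ (Fin 3)) (p : EuclideanSpace ℝ (Fin 3)) (v : EuclideanSpace ℝ (Fin 3)),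
          y₀ = p + v → ‖v‖ = 1 → p 0 ^ 2 + p 1 ^ 2 ≤ ρs ^ 2 → ‖y - y₀‖ ≤ L → y 0 ^ 2 + y 1 ^ 2 ≤ (ρ - 2) ^ 2 := by
        intro y₀ y p v hy₀ hv hp3 hd
        have h1 := sqrt_lateral_add_le y₀ (y - y₀); rw [add_sub_cancel] at h1
        have h2 := sqrt_lateral_add_le p v; rw [hv, ← hy₀] at h2
        have h3 : Real.sqrt (p 0 ^ 2 + p 1 ^ 2) ≤ ρs := by rw [← Real.sqrt_sq hρs0]; exact Real.sqrt_le_sqrt hp3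
        have h4 : Real.sqrt (y 0 ^ 2 + y 1 ^ 2) ≤ ρ - 2 := by rw [hρs] at h3; linarith only [h1, h2, h3, hd, hL]
        have h7 := pow_le_pow_left₀ (Real.sqrt_nonneg (y 0 ^ 2 + y 1 ^ 2)) h4 2; rwa [Real.sq_sqrt (by positivity : (0 : ℝ) ≤ y 0 ^ 2 + y 1 ^ 2)] at h7
      have hsq_of_sqrt : ∀ (p : EuclideanSpace ℝ (Fin 3)), Real.sqrt (p 0 ^ 2 + p 1 ^ 2) ≤ ρ - 1 →
          p 0 ^ 2 + p 1 ^ 2 ≤ (ρ - 1) ^ 2 := by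
        intro p hp
        have h7 := pow_le_pow_left₀ (Real.sqrt_nonneg (p 0 ^ 2 + p 1 ^ 2)) hp 2; rwa [Real.sq_sqrt (by positivity : (0 : ℝ) ≤ p 0 ^ 2 + p 1 ^ 2)] at h7
      -- GRAIN 1: fullness of the sample, end data, injectivity
      have hfull₁ : ∀ p ∈ S₁, p ∈ X ∧ ∀ w ∈ fccSlots, p + A₁ w ∈ X := by
        intro p hpS
        obtain ⟨hpΛ, hp1, hp2, hp3⟩ := (hS₁ p).1 hpS
        exact ⟨hP₁X ((hS₁mem p).1 hpS).1, fun w hw => hP₁X (inner_sample_full_window A₁ t₁ P₁ (-(2 * 10)) (-10) ρ hρ1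
          hP₁ hpΛ (by linarith only [hp1]) (by linarith only [hp2]) (by linarith only [hp3, hρs3]) hw)⟩
      have hH₁ : ∀ q ∈ X, ⟪q, e₃⟫_ℝ ≤ h + 20 := fun q hq => by rw [he₃i]; linarith only [(hcell q hq).2.1]
      have hend₁ : ∀ t ∈ T₁, (f₁ t).1 ∈ PAY ∧ deg (f₁ t).1 ≤ 11 ∧ WalkInv X e₃ (f₁ t) ∧ StackWF e₃ (f₁ t).2 ∧
          (f₁ t).2.getLast? = some ⟨A₁, u₁, 0⟩ ∧ (∃ e rest, (f₁ t).2 = e :: rest ∧ WalkCertified12 X (f₁ t).1 e) ∧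
          (∀ e ∈ (f₁ t).2, e.frame ∈ M₁) ∧ (f₁ t).1 ∈ reachSet A₁ t₁ M₁ := by
        intro p hp
        have hpS : p ∈ S₁ := by rw [hT₁def] at hp; exact (Finset.mem_filter.1 hp).1
        obtain ⟨hpΛ, hp1, hp2, hp3⟩ := (hS₁ p).1 hpS
        obtain ⟨hpX, hfull⟩ := hfull₁ p hpS
        have hy0X : p + A₁ u₁ ∈ X := hfull u₁ hu₁
        have hy02 : -20 ≤ (p + A₁ u₁) 2 := by linarith only [(hcell _ hy0X).1]
        have hNh : 8 * (h + 20 - ⟪p + A₁ u₁, e₃⟫_ℝ) < 3 * (N : ℝ) := by rw [he₃i]; linarith only [hN, hy02, hh]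
        have hI₀ : WalkInv X e₃ (p + A₁ u₁, [⟨A₁, u₁, 0⟩]) := walkInv_start A₁ hpX hfull hu₁ hsteep₁
        obtain ⟨hyX, hydeg, hrise, hdisp⟩ := grainWalk_end hX hs₀ hcert he₃n hH₁ A₁ hpX hfull hu₁ hsteep₁ hNh
        have hfw : walkEnd X e₃ N (p + A₁ u₁) [⟨A₁, u₁, 0⟩] = (f₁ p).1 := rfl; have hfw' : walkRun X e₃ N (p + A₁ u₁, [⟨A₁, u₁, 0⟩]) = f₁ p := rfl
        rw [hfw] at hyX hydeg hrise hdisp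
        have hy0eq : (p + A₁ u₁) 2 = p 2 + ⟪A₁ u₁, e₃⟫_ℝ := by rw [PiLp.add_apply, ← he₃i (A₁ u₁)]
        rw [he₃i] at hdisp
        have hlat2 := hlat_of (p + A₁ u₁) (f₁ p).1 p (A₁ u₁) rfl
          (by rw [LinearIsometryEquiv.norm_map, norm_eq_one_of_mem_fccSlots hu₁]) hp3
          (by rw [hL]; linarith only [hdisp, hy02])
        have hvalid := walkRun_valid hX hs₀ hcert he₃n N hI₀ (stackWF_start e₃ A₁ u₁)
        have hlast₁ : (f₁ p).2.getLast? = some ⟨A₁, u₁, 0⟩ := by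
          rw [← hfw', walkRun_getLast? hX hs₀ hcert he₃n N _ hI₀]; rfl
        have hfrM : ∀ e ∈ (f₁ p).2, e.frame ∈ M₁ := hM₁ (f₁ p).2 hvalid.1.2.1 hvalid.2 hlast₁
        have hylat : (f₁ p).1 0 ^ 2 + (f₁ p).1 1 ^ 2 ≤ (ρ - 1) ^ 2 := le_trans hlat2 (by nlinarith only [hρ])
        -- positional non-arrival: the end is in grain 1's reach set, a high end would be a far sample ball
        have hreach₁ : (f₁ p).1 ∈ reachSet A₁ t₁ M₁ :=
          walkEnd_mem_reachSet hX hs₀ hcert he₃n A₁ t₁ hM₁ hpΛ hpX hfull hu₁ hsteep₁ N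
        have hnothigh : (f₁ p).1 2 < h + 10 + 2 := by
          by_contra hge; push Not at hge
          by_cases hP : (f₁ p).1 ∈ P₂
          · exact hoff _ hreach₁ (mem_reachSet_of_mem_lattice ((hP₂ _).1 hP).1)
          · exact sealing_above A₂ t₂ (h + 10) (h + 2 * 10) ρ hρ1 X P₂ hX hP₂X' hP₂ _ hyX hP
              (by linarith only [hge]) (hcell _ hyX).2.1 hylat
        refine ⟨?_, hydeg, hvalid.1, hvalid.2, hlast₁, ?_, hfrM, hreach₁⟩
        · rw [hPAY, Finset.mem_filter]
          refine ⟨hyX, by show deg _ ≠ 12; exact fun h12 => by simp only [hdeg] at h12; omega, ?_, le_of_lt hnothigh⟩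
          rw [inner_sub_left, he₃i, he₃i] at hrise
          by_contra hlow; push Not at hlow; have hsqrt0 : 0 ≤ Real.sqrt 2 / 2 := by positivity
          exact not_unsaturated_in_slab A₁ t₁ (-(2 * 10)) (-10) ρ hρ1 X P₁ hX hP₁X hP₁ hyX
            (by linarith only [hrise, hy0eq, hp1, hsteep₁, hsqrt0]) (by linarith only [hlow]) hylat hydeg
        · rw [← hfw']
          exact walkRun_certified12 hX hs₀ hcert he₃n hI₀ ⟨⟨A₁, u₁, 0⟩, [], rfl, Or.inl ⟨by simpa using hpX,
            fun w hw => by simp only [add_sub_cancel_right]; exact hfull w hw⟩⟩ N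
      have hinj₁ : ∀ t ∈ T₁, ∀ t' ∈ T₁, f₁ t = f₁ t' → t = t' := by
        intro t ht t' ht' hft; rw [hT₁def, Finset.mem_filter] at ht ht'
        refine walkRun_start_injective hX hs₀ hcert he₃n A₁ t₁ hu₁ hsteep₁ S₁ (hlo := -19) (Hd := -11) (ρ' := ρ - 1)
          hρs0 (fun p hp => ?_) (fun p hp => (hfull₁ p hp).2) (fun p hpX hpΛ hlo hhi hlat w hw => ?_)
          (by linarith only [hρs17])
          (sample_interval A₁ t₁ P₁ S₁ hρs0 (by linarith only [hρsρ]) (by norm_num) (by norm_num) hP₁ hS₁mem hu₁)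
          ht.1 ht.2 ht'.1 ht'.2 hft
        · obtain ⟨hpΛ, hp1, hp2, hp3⟩ := (hS₁ p).1 hp
          exact ⟨(hfull₁ p hp).1, hpΛ, by rw [he₃i]; exact hp1, by rw [he₃i]; linarith only [hp2], hp3⟩
        · rw [he₃i] at hlo hhi
          exact hP₁X (inner_sample_full_window A₁ t₁ P₁ (-(2 * 10)) (-10) ρ hρ1 hP₁ hpΛ (by linarith only [hlo])
            (by linarith only [hhi]) (hsq_of_sqrt p hlat) hw)
      -- GRAIN 2
      have hfull₂ : ∀ p ∈ S₂, p ∈ X ∧ ∀ w ∈ fccSlots, p + A₂ w ∈ X := by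
        intro p hpS
        obtain ⟨hpΛ, hp1, hp2, hp3⟩ := (hS₂ p).1 hpS
        exact ⟨hP₂X' ((hS₂mem p).1 hpS).1, fun w hw => hP₂X' (inner_sample_full_window A₂ t₂ P₂ (h + 10) (h + 2 * 10) ρ
          hρ1 hP₂ hpΛ (by linarith only [hp1]) (by linarith only [hp2]) (by linarith only [hp3, hρs3]) hw)⟩
      have hH₂ : ∀ q ∈ X, ⟪q, -e₃⟫_ℝ ≤ 20 := fun q hq => by rw [inner_neg_right, he₃i]; linarith only [(hcell q hq).1]
      have hend₂ : ∀ t ∈ T₂, (f₂ t).1 ∈ PAY ∧ deg (f₂ t).1 ≤ 11 ∧ WalkInv X (-e₃) (f₂ t) ∧ StackWF (-e₃) (f₂ t).2 ∧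
          (f₂ t).2.getLast? = some ⟨A₂, u₂, 0⟩ ∧ (∃ e rest, (f₂ t).2 = e :: rest ∧ WalkCertified12 X (f₂ t).1 e) ∧
          (∀ e ∈ (f₂ t).2, e.frame ∈ M₂) ∧ (f₂ t).1 ∈ reachSet A₂ t₂ M₂ := by
        intro p hp
        have hpS : p ∈ S₂ := by rw [hT₂def] at hp; exact (Finset.mem_filter.1 hp).1
        obtain ⟨hpΛ, hp1, hp2, hp3⟩ := (hS₂ p).1 hpS
        obtain ⟨hpX, hfull⟩ := hfull₂ p hpS
        have hy0X : p + A₂ u₂ ∈ X := hfull u₂ hu₂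
        have hy02 : (p + A₂ u₂) 2 ≤ h + 20 := by linarith only [(hcell _ hy0X).2.1]
        have hy02' : -20 ≤ (p + A₂ u₂) 2 := by linarith only [(hcell _ hy0X).1]
        have hNh : 8 * (20 - ⟪p + A₂ u₂, -e₃⟫_ℝ) < 3 * (N : ℝ) := by rw [inner_neg_right, he₃i]; linarith only [hN, hy02, hh]
        have hI₀ : WalkInv X (-e₃) (p + A₂ u₂, [⟨A₂, u₂, 0⟩]) := walkInv_start A₂ hpX hfull hu₂ hsteep₂'
        obtain ⟨hyX, hydeg, hrise, hdisp⟩ := grainWalk_end hX hs₀ hcert hme₃n hH₂ A₂ hpX hfull hu₂ hsteep₂' hNh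
        have hfw : walkEnd X (-e₃) N (p + A₂ u₂) [⟨A₂, u₂, 0⟩] = (f₂ p).1 := rfl; have hfw' : walkRun X (-e₃) N (p + A₂ u₂, [⟨A₂, u₂, 0⟩]) = f₂ p := rfl
        rw [hfw] at hyX hydeg hrise hdisp
        have hy0eq : (p + A₂ u₂) 2 = p 2 + ⟪A₂ u₂, e₃⟫_ℝ := by rw [PiLp.add_apply, ← he₃i (A₂ u₂)]
        rw [inner_neg_right, he₃i] at hdisp
        have hlat2 := hlat_of (p + A₂ u₂) (f₂ p).1 p (A₂ u₂) rfl
          (by rw [LinearIsometryEquiv.norm_map, norm_eq_one_of_mem_fccSlots hu₂]) hp3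
          (by rw [hL]; linarith only [hdisp, hy02, hy02', hh])
        have hvalid := walkRun_valid hX hs₀ hcert hme₃n N hI₀ (stackWF_start (-e₃) A₂ u₂)
        have hlast₂ : (f₂ p).2.getLast? = some ⟨A₂, u₂, 0⟩ := by
          rw [← hfw', walkRun_getLast? hX hs₀ hcert hme₃n N _ hI₀]; rfl
        have hfrM : ∀ e ∈ (f₂ p).2, e.frame ∈ M₂ := hM₂ (f₂ p).2 hvalid.1.2.1 hvalid.2 hlast₂
        have hylat : (f₂ p).1 0 ^ 2 + (f₂ p).1 1 ^ 2 ≤ (ρ - 1) ^ 2 := le_trans hlat2 (by nlinarith only [hρ])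
        -- positional non-arrival for grain 2
        have hreach₂ : (f₂ p).1 ∈ reachSet A₂ t₂ M₂ :=
          walkEnd_mem_reachSet hX hs₀ hcert hme₃n A₂ t₂ hM₂ hpΛ hpX hfull hu₂ hsteep₂' N
        have hnotlow : (-10 : ℝ) - 2 < (f₂ p).1 2 := by
          by_contra hle; push Not at hle
          by_cases hP : (f₂ p).1 ∈ P₁
          · exact hoff _ (mem_reachSet_of_mem_lattice ((hP₁ _).1 hP).1) hreach₂
          · exact sealing_below A₁ t₁ (-(2 * 10)) (-10) ρ hρ1 X P₁ hX hP₁X hP₁ _ hyX hP (hcell _ hyX).1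
              (by linarith only [hle]) hylat
        refine ⟨?_, hydeg, hvalid.1, hvalid.2, hlast₂, ?_, hfrM, hreach₂⟩
        · rw [hPAY, Finset.mem_filter]
          refine ⟨hyX, by show deg _ ≠ 12; exact fun h12 => by simp only [hdeg] at h12; omega, ?_, ?_⟩
          · linarith only [hnotlow]
          rw [inner_sub_left, inner_neg_right, inner_neg_right, he₃i, he₃i] at hrise
          by_contra hhigh; push Not at hhigh; have hsqrt0 : 0 ≤ Real.sqrt 2 / 2 := by positivity
          exact not_unsaturated_in_slab A₂ t₂ (h + 10) (h + 2 * 10) ρ hρ1 X P₂ hX hP₂X' hP₂ hyX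
            (by linarith only [hhigh]) (by linarith only [hrise, hy0eq, hp2, hsteep₂, hsqrt0]) hylat hydeg
        · rw [← hfw']
          exact walkRun_certified12 hX hs₀ hcert hme₃n hI₀ ⟨⟨A₂, u₂, 0⟩, [], rfl, Or.inl ⟨by simpa using hpX,
            fun w hw => by simp only [add_sub_cancel_right]; exact hfull w hw⟩⟩ N
      have hinj₂ : ∀ t ∈ T₂, ∀ t' ∈ T₂, f₂ t = f₂ t' → t = t' := by
        intro t ht t' ht' hft; rw [hT₂def, Finset.mem_filter] at ht ht'
        refine walkRun_start_injective hX hs₀ hcert hme₃n A₂ t₂ hu₂ hsteep₂' S₂ (hlo := -(h + 19)) (Hd := -(h + 11))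
          (ρ' := ρ - 1) hρs0 (fun p hp => ?_) (fun p hp => (hfull₂ p hp).2) (fun p hpX hpΛ hlo hhi hlat w hw => ?_)
          (by linarith only [hρs17])
          (sample_interval A₂ t₂ P₂ S₂ hρs0 (by linarith only [hρsρ]) (by linarith only [hh]) (by linarith only [hh])
            hP₂ hS₂mem hu₂)
          ht.1 ht.2 ht'.1 ht'.2 hft
        · obtain ⟨hpΛ, hp1, hp2, hp3⟩ := (hS₂ p).1 hp
          exact ⟨(hfull₂ p hp).1, hpΛ, by rw [inner_neg_right, he₃i]; linarith only [hp2],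
            by rw [inner_neg_right, he₃i]; linarith only [hp1], hp3⟩
        · rw [inner_neg_right, he₃i] at hlo hhi
          exact hP₂X' (inner_sample_full_window A₂ t₂ P₂ (h + 10) (h + 2 * 10) ρ hρ1 hP₂ hpΛ (by linarith only [hhi])
            (by linarith only [hlo]) (hsq_of_sqrt p hlat) hw)
      -- THE COUNT: per payer ball, `deg + #fibre₁ + #fibre₂ ≤ 12`
      have hpt : ∀ y ∈ PAY, deg y + (T₁.filter fun t => (f₁ t).1 = y).card + (T₂.filter fun t => (f₂ t).1 = y).card ≤ 12 := by
        intro y hy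
        set fib₁ := T₁.filter fun t => (f₁ t).1 = y with hfib₁
        set fib₂ := T₂.filter fun t => (f₂ t).1 = y with hfib₂
        by_cases hemp : fib₁ = ∅ ∧ fib₂ = ∅
        · rw [hemp.1, hemp.2, Finset.card_empty]; have := hdeg12 y; omega
        -- `y` is an end ball: at most eleven contacts
        have hdegy : deg y ≤ 11 := by
          rw [not_and_or] at hemp
          rcases hemp with hne | hne
          · obtain ⟨t, ht⟩ := Finset.nonempty_iff_ne_empty.2 hne; obtain ⟨htT, hty⟩ := Finset.mem_filter.1 ht
            have := (hend₁ t htT).2.1; rw [hty] at this; exact this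
          · obtain ⟨t, ht⟩ := Finset.nonempty_iff_ne_empty.2 hne; obtain ⟨htT, hty⟩ := Finset.mem_filter.1 ht
            have := (hend₂ t htT).2.1; rw [hty] at this; exact this
        set ES₁ := fib₁.image f₁ with hES₁
        set ES₂ := fib₂.image f₂ with hES₂
        have hc₁ : ES₁.card = fib₁.card := Finset.card_image_of_injOn fun t ht t' ht' hft =>
          hinj₁ t (Finset.mem_filter.1 ht).1 t' (Finset.mem_filter.1 ht').1 hft
        have hc₂ : ES₂.card = fib₂.card := Finset.card_image_of_injOn fun t ht t' ht' hft =>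
          hinj₂ t (Finset.mem_filter.1 ht).1 t' (Finset.mem_filter.1 ht').1 hft
        have hES₁ok : ∀ s ∈ ES₁, s.1 = y ∧ WalkInv X e₃ s ∧ StackWF e₃ s.2 ∧ s.2.getLast? = some ⟨A₁, u₁, 0⟩ ∧
            (∃ e rest, s.2 = e :: rest ∧ WalkCertified12 X y e) ∧ ∀ e ∈ s.2, e.frame ∈ M₁ := by
          intro s hs
          obtain ⟨t, ht, rfl⟩ := Finset.mem_image.1 hs; obtain ⟨htT, hty⟩ := Finset.mem_filter.1 ht
          obtain ⟨-, -, hI, hW, hlast, hC, hfr, -⟩ := hend₁ t htT; rw [hty] at hC; exact ⟨hty, hI, hW, hlast, hC, hfr⟩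
        have hES₂ok : ∀ s ∈ ES₂, s.1 = y ∧ WalkInv X (-e₃) s ∧ StackWF (-e₃) s.2 ∧ s.2.getLast? = some ⟨A₂, u₂, 0⟩ ∧
            (∃ e rest, s.2 = e :: rest ∧ WalkCertified12 X y e) ∧ ∀ e ∈ s.2, e.frame ∈ M₂ := by
          intro s hs
          obtain ⟨t, ht, rfl⟩ := Finset.mem_image.1 hs; obtain ⟨htT, hty⟩ := Finset.mem_filter.1 ht
          obtain ⟨-, -, hI, hW, hlast, hC, hfr, -⟩ := hend₂ t htT; rw [hty] at hC; exact ⟨hty, hI, hW, hlast, hC, hfr⟩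
        -- the reach sets are disjoint: no ball is an end ball of BOTH grains
        have hone : fib₁ = ∅ ∨ fib₂ = ∅ := by
          by_contra hb
          rw [not_or] at hb
          obtain ⟨t, ht⟩ := Finset.nonempty_iff_ne_empty.2 hb.1; obtain ⟨t', ht'⟩ := Finset.nonempty_iff_ne_empty.2 hb.2
          obtain ⟨htT, hty⟩ := Finset.mem_filter.1 ht; obtain ⟨htT', hty'⟩ := Finset.mem_filter.1 ht'
          have h1 := (hend₁ t htT).2.2.2.2.2.2.2; have h2 := (hend₂ t' htT').2.2.2.2.2.2.2
          rw [hty] at h1; rw [hty'] at h2; exact hoff y h1 h2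
        rcases hone with h0 | h0
        · -- only grain 2 ends here
          have hES₁e : ES₁ = ∅ := by rw [hES₁, h0, Finset.image_empty]
          have key := card_contacts_add_endStates_le_twelve_sep hX hDS hCP (∅ : Set _) M₂
            (fun F₁ hF₁ _ _ => absurd hF₁ (Set.notMem_empty F₁)) hbb₂
            (z₁ := e₃) (z₂ := -e₃) hdegy (∅ : Finset _) ES₂ (fun s hs => absurd hs (Finset.notMem_empty s)) hES₂ok
          rw [Finset.card_empty, hc₂] at key
          rw [h0, Finset.card_empty]; omega
        · -- only grain 1 ends here
          have key := card_contacts_add_endStates_le_twelve_sep hX hDS hCP M₁ (∅ : Set _)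
            (fun F₁ _ F₂ hF₂ => absurd hF₂ (Set.notMem_empty F₂)) hbb₁
            (z₁ := e₃) (z₂ := -e₃) hdegy ES₁ (∅ : Finset _) hES₁ok (fun s hs => absurd hs (Finset.notMem_empty s))
          rw [Finset.card_empty, hc₁] at key
          rw [h0, Finset.card_empty]; omega
      -- summing over the payers
      have hsum₁ : T₁.card = ∑ y ∈ PAY, (T₁.filter fun t => (f₁ t).1 = y).card := Finset.card_eq_sum_card_fiberwise fun t ht => (hend₁ t ht).1
      have hsum₂ : T₂.card = ∑ y ∈ PAY, (T₂.filter fun t => (f₂ t).1 = y).card := Finset.card_eq_sum_card_fiberwise fun t ht => (hend₂ t ht).1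
      have hcount : (T₁.card : ℝ) + T₂.card ≤ ∑ y ∈ PAY, ((12 : ℝ) - ((X.filter fun q => dist y q = 1).card : ℝ)) := by
        rw [hsum₁, hsum₂]; push_cast; rw [← Finset.sum_add_distrib]
        refine Finset.sum_le_sum fun y hy => ?_
        have := hpt y hy
        have h' : (deg y : ℝ) + ((T₁.filter fun t => (f₁ t).1 = y).card : ℝ) +
            ((T₂.filter fun t => (f₂ t).1 = y).card : ℝ) ≤ 12 := by exact_mod_cast this
        simp only [hdeg] at h'; linarith
      linarith only [hcount, hT₁'', hT₂'']
    · -- SMALL CELL: the flux is within the error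
      push Not at hbig
      have h1 : (κ₁ + κ₂) * Real.pi ≤ 16 := by nlinarith only [hκ₁0, hκ₂0, hκ₁2, hκ₂2, hπ, hπ0]
      have h2 : (κ₁ + κ₂) * Real.pi * ρ ^ 2 ≤ 16 * ρ ^ 2 := mul_le_mul_of_nonneg_right h1 (sq_nonneg ρ)
      have h3 : ρ ^ 2 ≤ ρ * (11 + L) := by rw [sq]; exact mul_le_mul_of_nonneg_left hbig.le hρ0
      have hhρ : 0 ≤ h * ρ := mul_nonneg hh hρ0
      rw [hL] at h3; linarith only [h2, h3, hρ0, hhρ, hPAY0]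
  -- the two upper slab counts and the two splits
  have hD₁ := hC₁ (-(2 * 10)) (-10) (by ring) ρ hρ P₁ hP₁; have hD₂ := hC₂ (h + 10) (h + 2 * 10) (by ring) ρ hρ P₂ hP₂
  have hsplit₁ := contactDeficiency_sdiff_split hP₁X; have hsplit₂ := contactDeficiency_sdiff_split hP₂X
  have htwo := two_mul_contactDeficiency_eq_sum X; have hhρ : 0 ≤ h * ρ := mul_nonneg hh hρ0
  -- constants
  have hb : C₁ * ρ ≤ |C₁| * (1 + h) * ρ := by
    have h1 : 0 ≤ (|C₁| - C₁) * ρ := mul_nonneg (by linarith only [le_abs_self C₁]) hρ0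
    have h2 : 0 ≤ |C₁| * h * ρ := by positivity
    linarith only [h1, h2]
  have hc' : C₂ * ρ ≤ |C₂| * (1 + h) * ρ := by
    have h1 : 0 ≤ (|C₂| - C₂) * ρ := mul_nonneg (by linarith only [le_abs_self C₂]) hρ0
    have h2 : 0 ≤ |C₂| * h * ρ := by positivity
    linarith only [h1, h2]
  -- assemble
  set SP : ℝ := ∑ y ∈ PAY, ((12 : ℝ) - ((X.filter fun q => dist y q = 1).card : ℝ)) with hSP
  set C₀ : ℝ := 240 * Real.sqrt 2 * Real.pi + 4440 * (4 * 10 + 2) with hC₀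
  have hDX : φ₁ * Real.pi * ρ ^ 2 + φ₂ * Real.pi * ρ ^ 2 + SP / 2 - C₀ * (1 + h) * ρ / 2 ≤ contactDeficiency X := by linarith only [hled, htwo]
  have hcross : ((((P₁ ×ˢ (X \ P₁)).filter fun pq => dist pq.1 pq.2 = 1).card : ℕ) : ℝ) +
      ((((P₂ ×ˢ ((X \ P₁) \ P₂)).filter fun pq => dist pq.1 pq.2 = 1).card : ℕ) : ℝ) =
      contactDeficiency P₁ + contactDeficiency P₂ + contactDeficiency ((X \ P₁) \ P₂) - contactDeficiency X := by linarith only [hsplit₁, hsplit₂]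
  rw [hcross]
  have hSP : (κ₁ + κ₂) * Real.pi * ρ ^ 2 / 2 - 2000 * (1 + h) * ρ ≤ SP / 2 := by linarith only [hmain]
  have hC₀0 : 0 ≤ C₀ * (1 + h) * ρ := by positivity
  nlinarith only [hDX, hSP, hD₁, hD₂, hb, hc', hC₀0, hρ0, hh, hhρ]

end Summit.Ventures.Crystal3D.Theorems

end
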